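import Mathlib
import Literature.NumberTheory.LFunctions.WeilArchimedeanMoments
import Literature.NumberTheory.LFunctions.WeilChirpDecay
import HarnessLib

/-!
# The band form of the time–band limiting operator on window tests (handoff prove-1, ATTEMPT-17 §5; inputs of the 2×2 step of (TB-3) of LEMMA TB)

In LEMMA TB (HOME handoff/IDEAS-prolate.md §87) the time–band limiting operator `P = P_{a,H}` of the
pair `([-a,a], [-H,H])` enters only through its quadratic form on window tests,
`⟨Pg, g⟩ = (2π)⁻¹ ∫_{|t|<H} |ĝ(1/2 + it)|² dt`, its complement
`⟨(I - P)g, g⟩ = ‖g‖₂² - ⟨Pg, g⟩ = (2π)⁻¹ ∫_{|t| ≥ H} |ĝ(1/2 + it)|² dt` (Plancherel,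
`integral_norm_sq_weilMellin_half_line`), and the Cauchy–Schwarz inequality for the band form
`|∫_{|t|<H} û · conj ŵ| ≤ (∫_{|t|<H} |û|²)^{1/2} (∫_{|t|<H} |ŵ|²)^{1/2}` (the cross term of the
section/complement split, `HandoffLegendreLeakage.twoBand_section_lower`'s input `|R| ≤ ε_K X Y`).
This file proves these three facts for Weil tests, with the integrals written out (no new
definitions).  Nothing in this file bears on the truth of RH.
-/

set_option linter.dupNamespace false

open scoped Real ComplexConjugate
open Complex MeasureTheory Set Filter Literature.NumberTheory.LFunctions

namespace Summit.RiemannHypothesis.RiemannHypothesis.Theorems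

variable {g u w : ℝ → ℂ}

/-- **Plancherel split at the band edge.** For a Weil test `g` and any measurable set `S` of
frequencies: `∫_S |ĝ(1/2+it)|² + ∫_{Sᶜ} |ĝ(1/2+it)|² = 2π ‖g‖₂²`. -/
theorem setIntegral_norm_sq_weilMellin_add_compl (hg : IsWeilTest g) {S : Set ℝ}
    (hS : MeasurableSet S) :
    (∫ t in S, ‖weilMellin g (1 / 2 + t * I)‖ ^ 2) + ∫ t in Sᶜ, ‖weilMellin g (1 / 2 + t * I)‖ ^ 2 =
      2 * π * weilNorm2Sq g := by
  rw [integral_add_compl hS (integrable_norm_sq_weilMellin_half_line hg),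
    integral_norm_sq_weilMellin_half_line hg]

/-- The band part is between `0` and `2π ‖g‖₂²` (`0 ≤ P ≤ I` on window tests). -/
theorem setIntegral_norm_sq_weilMellin_le (hg : IsWeilTest g) (S : Set ℝ) :
    0 ≤ ∫ t in S, ‖weilMellin g (1 / 2 + t * I)‖ ^ 2 ∧
      ∫ t in S, ‖weilMellin g (1 / 2 + t * I)‖ ^ 2 ≤ 2 * π * weilNorm2Sq g := by
  refine ⟨integral_nonneg fun _ ↦ sq_nonneg _, ?_⟩
  rw [← integral_norm_sq_weilMellin_half_line hg]
  exact setIntegral_le_integral (integrable_norm_sq_weilMellin_half_line hg)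
    (Eventually.of_forall fun _ ↦ sq_nonneg _)

/-- `t ↦ |û(1/2+it)|` is in `L²` of any restricted measure (continuity + Plancherel). -/
theorem memLp_two_norm_weilMellin_line (hu : IsWeilTest u) (S : Set ℝ) :
    MemLp (fun t : ℝ ↦ ‖weilMellin u (1 / 2 + t * I)‖) 2 (volume.restrict S) := by
  have hc : Continuous fun t : ℝ ↦ ‖weilMellin u (1 / 2 + t * I)‖ :=
    (continuous_weilMellin_line hu).norm
  rw [memLp_two_iff_integrable_sq_norm hc.aestronglyMeasurable]
  have hi := (integrable_norm_sq_weilMellin_half_line hu).integrableOn (s := S)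
  refine hi.congr (Eventually.of_forall fun t ↦ ?_)
  simp only [norm_norm]

/-- **Cauchy–Schwarz for the band form.** For Weil tests `u, w` and any measurable set `S`:
`‖∫_S û(1/2+it) conj ŵ(1/2+it) dt‖² ≤ (∫_S |û|²) (∫_S |ŵ|²)`. -/
theorem norm_sq_setIntegral_weilMellin_mul_conj_le (hu : IsWeilTest u) (hw : IsWeilTest w)
    (S : Set ℝ) :
    ‖∫ t in S, weilMellin u (1 / 2 + t * I) * conj (weilMellin w (1 / 2 + t * I))‖ ^ 2 ≤
      (∫ t in S, ‖weilMellin u (1 / 2 + t * I)‖ ^ 2) * ∫ t in S, ‖weilMellin w (1 / 2 + t * I)‖ ^ 2 := by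
  set U : ℝ → ℝ := fun t ↦ ‖weilMellin u (1 / 2 + t * I)‖ with hU
  set W : ℝ → ℝ := fun t ↦ ‖weilMellin w (1 / 2 + t * I)‖ with hW
  have hU0 : 0 ≤ᵐ[volume.restrict S] U := Eventually.of_forall fun _ ↦ norm_nonneg _
  have hW0 : 0 ≤ᵐ[volume.restrict S] W := Eventually.of_forall fun _ ↦ norm_nonneg _
  have hUm : MemLp U (ENNReal.ofReal 2) (volume.restrict S) := by
    rw [show ENNReal.ofReal 2 = 2 by norm_num]; exact memLp_two_norm_weilMellin_line hu S
  have hWm : MemLp W (ENNReal.ofReal 2) (volume.restrict S) := by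
    rw [show ENNReal.ofReal 2 = 2 by norm_num]; exact memLp_two_norm_weilMellin_line hw S
  -- Hölder with p = q = 2
  have hH := integral_mul_le_Lp_mul_Lq_of_nonneg Real.HolderConjugate.two_two hU0 hW0 hUm hWm
  -- `‖∫ û conj ŵ‖ ≤ ∫ |û| |ŵ|`
  have h1 : ‖∫ t in S, weilMellin u (1 / 2 + t * I) * conj (weilMellin w (1 / 2 + t * I))‖ ≤
      ∫ t in S, U t * W t := by
    refine (norm_integral_le_integral_norm _).trans (le_of_eq ?_)
    refine integral_congr_ae (Eventually.of_forall fun t ↦ ?_)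
    simp only [hU, hW, norm_mul, Complex.norm_conj]
  have hA0 : 0 ≤ ∫ t in S, U t ^ 2 := integral_nonneg fun _ ↦ sq_nonneg _
  have hB0 : 0 ≤ ∫ t in S, W t ^ 2 := integral_nonneg fun _ ↦ sq_nonneg _
  -- square Hölder's right-hand side
  have hsq : ((∫ t in S, U t ^ (2 : ℝ)) ^ (1 / (2 : ℝ)) * (∫ t in S, W t ^ (2 : ℝ)) ^ (1 / (2 : ℝ))) ^ 2 =
      (∫ t in S, U t ^ 2) * ∫ t in S, W t ^ 2 := by
    have eU : ∫ t in S, U t ^ (2 : ℝ) = ∫ t in S, U t ^ 2 :=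
      integral_congr_ae (Eventually.of_forall fun t ↦ by simp)
    have eW : ∫ t in S, W t ^ (2 : ℝ) = ∫ t in S, W t ^ 2 :=
      integral_congr_ae (Eventually.of_forall fun t ↦ by simp)
    have key : ∀ x : ℝ, 0 ≤ x → (x ^ (1 / (2 : ℝ))) ^ 2 = x := fun x hx ↦ by
      rw [← Real.rpow_natCast, ← Real.rpow_mul hx]; norm_num
    rw [eU, eW, mul_pow, key _ hA0, key _ hB0]
  have h0 : 0 ≤ ‖∫ t in S, weilMellin u (1 / 2 + t * I) * conj (weilMellin w (1 / 2 + t * I))‖ :=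
    norm_nonneg _
  calc ‖∫ t in S, weilMellin u (1 / 2 + t * I) * conj (weilMellin w (1 / 2 + t * I))‖ ^ 2
      ≤ (∫ t in S, U t * W t) ^ 2 := pow_le_pow_left₀ h0 h1 2
    _ ≤ ((∫ t in S, U t ^ (2 : ℝ)) ^ (1 / (2 : ℝ)) * (∫ t in S, W t ^ (2 : ℝ)) ^ (1 / (2 : ℝ))) ^ 2 :=
        pow_le_pow_left₀ (integral_nonneg fun t ↦ mul_nonneg (norm_nonneg _) (norm_nonneg _)) hH 2
    _ = (∫ t in S, U t ^ 2) * ∫ t in S, W t ^ 2 := hsq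

/-! ### Expansion of the band form of a sum (appended 2026-08-24, prove-1 gen10) -/

/-- The cross density `û conj ŵ` on the line is integrable (AM–GM against the two Plancherel
densities). -/
theorem integrable_weilMellin_mul_conj_line (hu : IsWeilTest u) (hw : IsWeilTest w) :
    Integrable fun t : ℝ ↦ weilMellin u (1 / 2 + t * I) * conj (weilMellin w (1 / 2 + t * I)) := by
  have hc : Continuous fun t : ℝ ↦ weilMellin u (1 / 2 + t * I) * conj (weilMellin w (1 / 2 + t * I)) :=
    (continuous_weilMellin_line hu).mul (Complex.continuous_conj.comp (continuous_weilMellin_line hw))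
  refine Integrable.mono' (((integrable_norm_sq_weilMellin_half_line hu).add
    (integrable_norm_sq_weilMellin_half_line hw)).div_const 2) hc.aestronglyMeasurable
    (Eventually.of_forall fun t ↦ ?_)
  rw [norm_mul, Complex.norm_conj]
  simp only [Pi.add_apply]
  nlinarith [sq_nonneg (‖weilMellin u (1 / 2 + t * I)‖ - ‖weilMellin w (1 / 2 + t * I)‖)]

/-- **Expansion of the band form of a sum.** For Weil tests `u, w` and a measurable set `S`:
`∫_S |(u+w)^(1/2+it)|² = ∫_S |û|² + 2 Re ∫_S û conj ŵ + ∫_S |ŵ|²`. -/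
theorem setIntegral_norm_sq_weilMellin_add (hu : IsWeilTest u) (hw : IsWeilTest w) (S : Set ℝ) :
    ∫ t in S, ‖weilMellin (u + w) (1 / 2 + t * I)‖ ^ 2 =
      (∫ t in S, ‖weilMellin u (1 / 2 + t * I)‖ ^ 2) +
        2 * (∫ t in S, weilMellin u (1 / 2 + t * I) * conj (weilMellin w (1 / 2 + t * I))).re +
        ∫ t in S, ‖weilMellin w (1 / 2 + t * I)‖ ^ 2 := by
  have hadd : ∀ t : ℝ, weilMellin (u + w) (1 / 2 + t * I) =
      weilMellin u (1 / 2 + t * I) + weilMellin w (1 / 2 + t * I) := fun t ↦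
    weilMellin_add hu.1.continuous hu.2 hw.1.continuous hw.2 _
  have hpt : ∀ t : ℝ, ‖weilMellin (u + w) (1 / 2 + t * I)‖ ^ 2 =
      ‖weilMellin u (1 / 2 + t * I)‖ ^ 2 +
        2 * (weilMellin u (1 / 2 + t * I) * conj (weilMellin w (1 / 2 + t * I))).re +
        ‖weilMellin w (1 / 2 + t * I)‖ ^ 2 := fun t ↦ by
    rw [hadd, Complex.sq_norm, Complex.sq_norm, Complex.sq_norm, Complex.normSq_add]
    ring
  have hiU := (integrable_norm_sq_weilMellin_half_line hu).integrableOn (s := S)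
  have hiW := (integrable_norm_sq_weilMellin_half_line hw).integrableOn (s := S)
  have hiX := (integrable_weilMellin_mul_conj_line hu hw).integrableOn (s := S)
  have hiXre : IntegrableOn (fun t : ℝ ↦
      2 * (weilMellin u (1 / 2 + t * I) * conj (weilMellin w (1 / 2 + t * I))).re) S :=
    (hiX.re).const_mul 2
  have hi1 : IntegrableOn (fun t : ℝ ↦ ‖weilMellin u (1 / 2 + t * I)‖ ^ 2 +
      2 * (weilMellin u (1 / 2 + t * I) * conj (weilMellin w (1 / 2 + t * I))).re) S :=
    hiU.add hiXre
  have hre : ∫ t in S, (weilMellin u (1 / 2 + t * I) * conj (weilMellin w (1 / 2 + t * I))).re =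
      (∫ t in S, weilMellin u (1 / 2 + t * I) * conj (weilMellin w (1 / 2 + t * I))).re := by
    have h := integral_re hiX
    simpa only [RCLike.re_to_complex] using h
  simp_rw [hpt]
  rw [integral_add hi1 hiW, integral_add hiU hiXre, MeasureTheory.integral_const_mul, hre]

end Summit.RiemannHypothesis.RiemannHypothesis.Theorems
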